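/-
Copyright (c) 2026 the pub-hodgecm-mathlib formalisation cell (harness21).  Prover seat hodgecm-mathlib-K2Liu-p09 (g6): Track B «K2-LIT»,
hLiu418 = stmt-HodgeConjecture-24832; LEAD F0P6-plan RULINGS M-156m∕m′∕o, M-157a (4)∕c «A7 = GK COCYCLE ROAD», file B8-CM (frame discharge + CM datum).
-/
import Summits.HodgeConjecture.HodgeConjecture.Theorems.K2LiuA7NormalisedRegularity             -- ★ B7 (every place; frame as binders)
import Literature.NumberTheory.GelbartRogawski1991.DoubledWeilRepresentationLocalFamilyCM      -- ★ `gramR_isSymm`, `hermD_eq_map_gramD`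
import Literature.NumberTheory.GelbartRogawski1991.DoubledWeilRepresentationArchLagrangian     -- ★ `isUnit_det_gramR₀`
import Literature.NumberTheory.GelbartRogawski1991.UnitaryDualPairThetaKernelCM                -- ★ `imagUnit`, `complexConj_imagUnit`, `imagUnit_ne_zero`, `imagUnit_mul_self`
import HarnessLib

/-!
# Crux `HLiu418`, road `K2_Liu`, organ A7-reg (GK cocycle road), file B8-CM:
# THE (A4′-R) FACE WITHOUT FRAME BINDERS, AND AT THE CM DATUM `(L⁺, L, c, δ_L; T = gramR, J = hermD)` — the body of the face of record `FaceA4primeR` at `n = 2`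

Cell `hodgecm-mathlib`, crux item hLiu418 = `stmt-HodgeConjecture-24832`; squad K2 ∕ K2Liu; prover K2Liu-p09 (g6).  THEOREMS ONLY; lane
`--supports stmt-HodgeConjecture-24832` (count-neutral helper).
THE POINT.  ★ B7 `K2LiuA7NormalisedRegularity.normalisedRegularity` proves the (A4′-R) face (RULING M-156m: ⟦R-χ⟧ unitarity, ⟦R-Iw⟧ Iwasawa compact `K₀` as data,
⟦R-sm⟧ smoothness) at every finite place for the generic doubled datum `(F, E, c, δ, d, v, T₂, J₂D)`, with the Δ-ADAPTED FRAME `(D, D⁻¹, Q = e₂∘(1 D; 1 −D),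
Qᵀ (T₂ ⊕ −T₂) Q = J₄)` as seven binders (RULING M-156o (c): one frame, owned by K2Liu-p03).  This file discharges them:
* §1 `exists_adaptedFrame` — for `T₀` symmetric with `det T₀` a unit (every rank `n`), the frame EXISTS: `D = ½ T₀⁻¹ W`, `D⁻¹ = 2 W T₀`, `Q = e₂∘(1 D; 1 −D)`
  (the construction inside ★ `K2LiuLocalSiegelIwasawa.exists_isSiegelDelta_mul_mem_localInt`, exported; ★ `K2LiuLocalSiegelIwasawaFrame.frame_mul_frameInv` ∕
  `frameInv_mul_frame` ∕ `frame_transpose_mul_gram_mul_frame` ∕ `reindex_antidiag_eq_antidiagonal_over`).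
* §2 `normalisedRegularity_cm` — the CM datum of the road (`F = L⁺`, `E = L`, `c` = complex conjugation, `δ = imagUnit L`, `T₂ = gramR L e dV dW` for a product frame
  `e : Fin N × Fin M ≃ Fin 2` — the curve case `N = 2, M = 1` — and `J = hermD`): the BODY of K2Liu-p03 (g6)'s face of record `FaceA4primeR … νN χv`
  (`K2/K2Liu-p03/g6/FaceA4R.K2Liu-p03-g6.lean` e56f811bc64cfc2c) at `n = 2`, binder for binder (⟦R-χ⟧ `_hχ` first), from ★ B7, §1 and ★ `gramR_isSymm`, ★ `hermD_eq_map_gramD`,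
  ★ `isUnit_det_gramR₀` (the datum's `dV i ≠ 0`, `dW i ≠ 0` sit OUTSIDE the face).  K2Liu-p03's good-place bridge B8 (`K₀ := H(𝒪_v)`) composes after §2 (or after ★ B7 + §1 at the generic datum).
HONEST LABEL.  `HC_CM` is proved only modulo the 7 printed citations (2 remaining named inputs: hLiu418 = `stmt-HodgeConjecture-24832`,
h413 = `stmt-HodgeConjecture-24833`) until rung 0 closes.

## References
* [HarrisKudlaSweet1996] M. Harris, S. Kudla, W. J. Sweet, J. AMS 9 (1996), §1 (1.11) (the frame of the doubled space), §6 (6.14)–(6.16).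
* [KudlaSweet1997] S. Kudla, W. J. Sweet, Israel J. Math. 98 (1997), §1.
* [Casselman1980] W. Casselman, Compositio Math. 40 (1980), §3 Thm. 3.1.
* [GelbartRogawski1991] S. Gelbart, J. Rogawski, *L-functions and Fourier–Jacobi coefficients for the unitary group U(3)*, Invent. Math. 105 (1991), §3.1 Prop. 3.1.1
  (the CM doubled datum `T = gramR`, `J = hermD`).
-/

set_option autoImplicit false
set_option linter.dupNamespace false -- the mandated namespace repeats `HodgeConjecture.HodgeConjecture`

noncomputable section

open scoped Classical NNReal ENNReal
open NumberField IsDedekindDomain Matrix MeasureTheory Topology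
open Literature.NumberTheory.GaloisRepresentations.IsNonarchimedeanLocalField
open Literature.NumberTheory.Automorphic Literature.NumberTheory.Automorphic.UnitaryGroup
open Literature.NumberTheory.GelbartRogawski1991
open Literature.NumberTheory.GelbartRogawski1991.AdaptedBlocks
open Literature.NumberTheory.GelbartRogawski1991.UnitaryDualPair.LocalSplitting
open Literature.NumberTheory.K2Lit.LocalSiegelDoubled
open Summit.HodgeConjecture.HodgeConjecture.Cruxes.HLiu418.K2LiuQRationalDefs
open Summit.HodgeConjecture.HodgeConjecture.Cruxes.HLiu418.K2LiuLocalLFactorDefs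
open Summit.HodgeConjecture.HodgeConjecture.Cruxes.HLiu418.K2LiuLocalSiegelIwasawaFrame
open Summit.HodgeConjecture.HodgeConjecture.Cruxes.HLiu418.K2LiuLocalSiegelIwasawa
open Summit.HodgeConjecture.HodgeConjecture.Cruxes.HLiu418.K2LiuDoubledUTwoTwoFrameTransport
open Summit.HodgeConjecture.HodgeConjecture.Cruxes.HLiu418.K2LiuDoubledUTwoTwoUnipotentHaar
open Summit.HodgeConjecture.HodgeConjecture.Cruxes.HLiu418.K2LiuA7NormalisedRegularity

namespace Summit.HodgeConjecture.HodgeConjecture.Cruxes.HLiu418.K2LiuA7NormalisedRegularityCM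

/-! ## §1 The Δ-adapted frame exists whenever `det T₀` is a unit -/

section Frame

variable (F : Type) [Field F] [NumberField F] (n : ℕ) {T₀ : Matrix (Fin n) (Fin n) F}

/-- **THE Δ-ADAPTED FRAME EXISTS** for `T₀` symmetric with `det T₀` a unit: `D = ½ T₀⁻¹ W`, `D⁻¹ = 2 W T₀` (`W` the antidiagonal permutation), `Q = e₂ ∘ (1 D; 1 −D)`
with `Qᵀ (T₀ ⊕ −T₀) Q = J_{2n}` — the seven frame binders `(D, Dinv, hDD, hDD', Q, hQm, hQ)` of ★ B7 (the construction of ★ `exists_isSiegelDelta_mul_mem_localInt`, exported).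
[cite: HarrisKudlaSweet1996, §1 (1.11)] -/
theorem exists_adaptedFrame (hT₀ : T₀.IsSymm) (hT₀d : IsUnit T₀.det) :
    ∃ (D Dinv : Matrix (Fin n) (Fin n) F) (Q : GL (Fin (n + n)) F), D * Dinv = 1 ∧ Dinv * D = 1 ∧
      (Q : Matrix (Fin (n + n)) (Fin (n + n)) F) = Matrix.reindex (e₂ n) (e₂ n) (Matrix.fromBlocks 1 D 1 (-D)) ∧
      (Q : Matrix (Fin (n + n)) (Fin (n + n)) F)ᵀ * gramD F n T₀ * (Q : Matrix (Fin (n + n)) (Fin (n + n)) F) = (StdForm.antidiagonal (n + n)).over F := by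
  obtain ⟨D, hD⟩ : ∃ D : Matrix (Fin n) (Fin n) F, D = (2 : F)⁻¹ • (T₀⁻¹ * (1 : Matrix (Fin n) (Fin n) F).submatrix id Fin.rev) := ⟨_, rfl⟩
  obtain ⟨Qm, hQm⟩ : ∃ Qm : Matrix (Fin (n + n)) (Fin (n + n)) F, Qm = Matrix.reindex (e₂ n) (e₂ n) (Matrix.fromBlocks 1 D 1 (-D)) := ⟨_, rfl⟩
  obtain ⟨Qi, hQi⟩ : ∃ Qi : Matrix (Fin (n + n)) (Fin (n + n)) F, Qi = Matrix.reindex (e₂ n) (e₂ n)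
      (Matrix.fromBlocks ((2 : F)⁻¹ • (1 : Matrix (Fin n) (Fin n) F)) ((2 : F)⁻¹ • 1)
        ((1 : Matrix (Fin n) (Fin n) F).submatrix Fin.rev id * T₀) (-((1 : Matrix (Fin n) (Fin n) F).submatrix Fin.rev id * T₀))) := ⟨_, rfl⟩
  have hmul : Qm * Qi = 1 := by
    rw [hQm, hQi, reindex_mul_reindex, hD, frame_mul_frameInv hT₀d, Matrix.reindex_apply, Matrix.submatrix_one_equiv]
  have hmul' : Qi * Qm = 1 := by
    rw [hQm, hQi, reindex_mul_reindex, hD, frameInv_mul_frame hT₀d, Matrix.reindex_apply, Matrix.submatrix_one_equiv]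
  have hQ : Qmᵀ * gramD F n T₀ * Qm = (StdForm.antidiagonal (n + n)).over F := by
    rw [hQm, gramD, Matrix.transpose_reindex, reindex_mul_reindex, reindex_mul_reindex, hD, frame_transpose_mul_gram_mul_frame hT₀ hT₀d,
      reindex_antidiag_eq_antidiagonal_over]
  have hDG : D * ((2 : F) • ((1 : Matrix (Fin n) (Fin n) F).submatrix Fin.rev id * T₀)) = 1 := by
    rw [hD, Matrix.smul_mul, Matrix.mul_smul, smul_smul, inv_mul_cancel₀ (two_ne_zero : (2 : F) ≠ 0), one_smul, Matrix.mul_assoc,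
      ← Matrix.mul_assoc ((1 : Matrix (Fin n) (Fin n) F).submatrix id Fin.rev), antidiag_mul_antidiag, Matrix.one_mul, Matrix.nonsing_inv_mul T₀ hT₀d]
  have hGD : ((2 : F) • ((1 : Matrix (Fin n) (Fin n) F).submatrix Fin.rev id * T₀)) * D = 1 := by
    rw [hD, Matrix.smul_mul, Matrix.mul_smul, smul_smul, mul_inv_cancel₀ (two_ne_zero : (2 : F) ≠ 0), one_smul, Matrix.mul_assoc,
      ← Matrix.mul_assoc T₀, Matrix.mul_nonsing_inv T₀ hT₀d, Matrix.one_mul, antidiag_mul_antidiag']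
  exact ⟨D, (2 : F) • ((1 : Matrix (Fin n) (Fin n) F).submatrix Fin.rev id * T₀), ⟨Qm, Qi, hmul, hmul'⟩, hDG, hGD, hQm, hQ⟩

end Frame

/-! ## §2 The CM datum: the body of the face of record `FaceA4primeR` at `n = 2` -/

section CM

variable (L : Type) [Field L] [NumberField L] [IsCMField L] {N M : ℕ} (e : Fin N × Fin M ≃ Fin 2)
  (dV : Fin N → L) (hdV : ∀ i, IsCMField.complexConj L (dV i) = dV i) (hdV0 : ∀ i, dV i ≠ 0)
  (dW : Fin M → L) (hdW : ∀ i, IsCMField.complexConj L (dW i) = dW i) (hdW0 : ∀ i, dW i ≠ 0)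
  (v : HeightOneSpectrum (𝓞 (GRConstruction.Fp L)))

set_option maxHeartbeats 400000 in -- measured 2026-09-04: instantiating ★ B7 at the CM datum `(L⁺, L, gramR, hermD)` times out at `whnf` with 200 000; 400 000 passes
include hdV0 hdW0 in
/-- **(A4′-R) AT THE CM DATUM, `n = 2`** — for the doubled CM datum `H_v = U(𝕎 ⊕ −𝕎)(L⁺_v)`, `𝕎 = V ⊗ W` of rank `2` (`T = gramR L e dV dW`, `J = hermD`,
`δ = imagUnit L`): for every unitary `χ_v`, every compact open `K₀ ≤ H_v` with `H_v = P_Δ(L⁺_v)·K₀` and every `K₀`-flat family `f` of smooth Siegel sections of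
`I_v(s, χ_v)` there is `Fn : ℂ → H_v → ℂ`, each `s ↦ Fn s h` rational in `q_v^{-s}` and regular at `½`, with `M_v(s)(f s) h = aNorm 2 χ_v (νN(N_Δ ∩ K₀)) s · Fn s h`
on `1 < re s` — the body of the face of record `FaceA4primeR … νN χv` at `n = 2`, binder for binder (★ B7 at the CM datum with the frame of §1; ★ `gramR_isSymm`,
★ `hermD_eq_map_gramD`, ★ `isUnit_det_gramR₀`). [cite: GelbartRogawski1991, §3.1 Prop. 3.1.1] [cite: KudlaSweet1997, §1] [cite: HarrisKudlaSweet1996, §6 (6.14)–(6.16)] [cite: Casselman1980, §3 Thm. 3.1] -/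
theorem normalisedRegularity_cm
    [MeasurableSpace (unipDeltaLocal (GRConstruction.Fp L) L (IsCMField.complexConj L) v 2 (JD := GRConstruction.hermD L e dV hdV dW hdW))] [BorelSpace (unipDeltaLocal (GRConstruction.Fp L) L (IsCMField.complexConj L) v 2 (JD := GRConstruction.hermD L e dV hdV dW hdW))]
    (νN : Measure (unipDeltaLocal (GRConstruction.Fp L) L (IsCMField.complexConj L) v 2 (JD := GRConstruction.hermD L e dV hdV dW hdW))) [νN.IsHaarMeasure]
    (χv : ∀ w : PlacesOver L v, (w.1.adicCompletion L)ˣ →* ℂˣ) :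
    haveI : Algebra.IsQuadraticExtension (GRConstruction.Fp L) L := IsCMField.isQuadraticExtension L
    ∀ (_hχ : ∀ (w' : PlacesOver L v) (x : (w'.1.adicCompletion L)ˣ), ‖((χv w' x : ℂˣ) : ℂ)‖ = 1)
      (K₀ : Subgroup (UnitaryGroup.localPi L (IsCMField.complexConj L) (2 + 2) (GRConstruction.hermD L e dV hdV dW hdW) v))
      (_hK₀ : IsCompact (K₀ : Set (UnitaryGroup.localPi L (IsCMField.complexConj L) (2 + 2) (GRConstruction.hermD L e dV hdV dW hdW) v)) ∧ IsOpen (K₀ : Set (UnitaryGroup.localPi L (IsCMField.complexConj L) (2 + 2) (GRConstruction.hermD L e dV hdV dW hdW) v)))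
      (_hIw : ∀ g : UnitaryGroup.localPi L (IsCMField.complexConj L) (2 + 2) (GRConstruction.hermD L e dV hdV dW hdW) v,
        ∃ p, IsSiegelDelta (GRConstruction.Fp L) L (IsCMField.complexConj L) (UnitaryDualPair.complexConj_imagUnit L) (UnitaryDualPair.imagUnit_ne_zero L) (UnitaryDualPair.imagUnit_mul_self L)
        v 2 (GRConstruction.gramR_isSymm L e dV hdV dW hdW) (GRConstruction.hermD_eq_map_gramD L e dV hdV dW hdW) p ∧ ∃ k ∈ K₀, g = p * k)
      (f : ℂ → UnitaryGroup.localPi L (IsCMField.complexConj L) (2 + 2) (GRConstruction.hermD L e dV hdV dW hdW) v → ℂ),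
      (∀ s, IsLocalSiegelSection (GRConstruction.Fp L) L (IsCMField.complexConj L) (UnitaryDualPair.complexConj_imagUnit L) (UnitaryDualPair.imagUnit_ne_zero L) (UnitaryDualPair.imagUnit_mul_self L)
        v 2 (GRConstruction.gramR_isSymm L e dV hdV dW hdW) (GRConstruction.hermD_eq_map_gramD L e dV hdV dW hdW) χv s (f s)) →
      (∀ s, IsSmooth (GRConstruction.Fp L) L (IsCMField.complexConj L) v 2 (f s)) →
      (∀ s s' : ℂ, ∀ k ∈ K₀, f s k = f s' k) →
      ∃ Fn : ℂ → UnitaryGroup.localPi L (IsCMField.complexConj L) (2 + 2) (GRConstruction.hermD L e dV hdV dW hdW) v → ℂ,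
        (∀ h, IsQRationalRegularAt (residueFieldCard (v.adicCompletion (GRConstruction.Fp L))) (1 / 2) (fun s => Fn s h)) ∧
        ∀ s : ℂ, 1 < s.re → ∀ h : UnitaryGroup.localPi L (IsCMField.complexConj L) (2 + 2) (GRConstruction.hermD L e dV hdV dW hdW) v,
          localIntertwining (GRConstruction.Fp L) L (IsCMField.complexConj L) v 2 (GRConstruction.hermD_eq_map_gramD L e dV hdV dW hdW) νN (f s) h =
            aNorm (GRConstruction.Fp L) L (IsCMField.complexConj L) v 2 χv (νN.real {u | (u : UnitaryGroup.localPi L (IsCMField.complexConj L) (2 + 2) (GRConstruction.hermD L e dV hdV dW hdW) v) ∈ K₀}) s * Fn s h := by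
  haveI : Algebra.IsQuadraticExtension (GRConstruction.Fp L) L := IsCMField.isQuadraticExtension L
  intro hχ K₀ hK₀ hIw f hSieg hsm hflat
  obtain ⟨D, Dinv, Q, hDD, hDD', hQm, hQ⟩ :=
    exists_adaptedFrame (GRConstruction.Fp L) 2 (GRConstruction.gramR_isSymm L e dV hdV dW hdW) (GRConstruction.isUnit_det_gramR₀ L e dV hdV hdV0 dW hdW hdW0)
  exact normalisedRegularity (GRConstruction.Fp L) L (IsCMField.complexConj L) (UnitaryDualPair.complexConj_imagUnit L) (UnitaryDualPair.imagUnit_ne_zero L)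
    (UnitaryDualPair.imagUnit_mul_self L) v (GRConstruction.gramR_isSymm L e dV hdV dW hdW) (GRConstruction.hermD_eq_map_gramD L e dV hdV dW hdW)
    D Dinv hDD hDD' Q hQm hQ νN χv hχ K₀ hK₀ hIw f hSieg hsm hflat

end CM

end Summit.HodgeConjecture.HodgeConjecture.Cruxes.HLiu418.K2LiuA7NormalisedRegularityCM

end
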